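import Mathlib
import HarnessLib

/-!
# The PERIODIC massive-mode rung, brick PM-IId-core: CONTINUITY OF SUBLEVEL VOLUMES along the two-scale filter
# (free-hands support of ⟨stmt-QuantumFields-24196⟩ `SwapVirialDeficit.ToronSoftnessSharp`; the dominated-convergence core of LEAD ym-line-sfw-p2 g96's PM-IId
# `Tendsto (V · · ·) ((𝓝[>]0 ×ˢ 𝓝[>]0) ×ˢ 𝓝 a₀) (𝓝 (M a₀))` with `V u s a = μ{ξ | Φ(u,s,a;ξ) ≤ 1}`, `M a₀ = μ{ξ | Φ(0,0,a₀;ξ) ≤ 1}`)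

GENERIC measure theory (✓Mathlib `tendsto_measure_of_ae_tendsto_indicator`): along any countably generated filter `L`, if `Φᵢ(x) → Φ₀(x)` for a.e. `x`,
the level set `{Φ₀ = c}` is null, and the sublevel sets `{Φᵢ ≤ c}` eventually lie in a set of finite measure, then `μ{Φᵢ ≤ c} → μ{Φ₀ ≤ c}`
(★★ `tendsto_measure_sublevel`).  ★ `tendsto_measure_sublevel_twoScale`: the instance `L = (𝓝[>]0 ×ˢ 𝓝[>]0) ×ˢ 𝓝 a₀`, with the pointwise hypothesis discharged from
JOINT CONTINUITY of `(u,s,a) ↦ Φ(u,s,a;ξ)` at `(0,0,a₀)` (as delivered by ✓`exists_continuous_twoVarHadamard[_of_contDiff]`) via `tendsto_twoScale_of_continuousAt`.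
HONEST LABEL: measure theory; PM-IId's domination and null-level inputs (LEAD g96, PM-IIc/IIb′) are NOT proved here; ⟨24196⟩/⟨24497⟩ OPEN; own crux ⟨22884⟩ OPEN
(blocked-on ⟨19935⟩); the Yang–Mills mass gap is NOT proved; no summit is proved by a line.  Width seat ym-line-sfw-p2-w3 g64 (cell ym-idea-1, free hands),
`--supports stmt-QuantumFields-24196`.  THEOREMS ONLY (0 `def`, 0 `sorry`), standard axioms.  References: [folklore] (dominated convergence for indicators);
[cite: Luscher1983, §2] for the use.
-/

set_option autoImplicit false

noncomputable section

open Set Filter Topology MeasureTheory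
open scoped ENNReal

namespace Summit.QuantumFields.YangMills.Theorems.SwapVirialDeficit.BlowUp

/-- Off the level `c`, a convergent net decides `≤ c` eventually as its limit does. [folklore] -/
theorem eventually_le_iff_of_tendsto {ι : Type*} {L : Filter ι} {f : ι → ℝ} {a c : ℝ} (h : Tendsto f L (𝓝 a)) (ha : a ≠ c) :
    ∀ᶠ i in L, f i ≤ c ↔ a ≤ c := by
  rcases lt_or_gt_of_ne ha with hlt | hgt
  · filter_upwards [h.eventually (gt_mem_nhds hlt)] with i hi
    exact ⟨fun _ => hlt.le, fun _ => hi.le⟩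
  · filter_upwards [h.eventually (lt_mem_nhds hgt)] with i hi
    exact ⟨fun h' => absurd h' (not_le.2 hi), fun h' => absurd h' (not_le.2 hgt)⟩

/-- ★★ **SUBLEVEL VOLUMES CONVERGE** (a.e. pointwise convergence + null level + eventual domination by a finite-measure set). [folklore] -/
theorem tendsto_measure_sublevel {X ι : Type*} [MeasurableSpace X] {μ : Measure X} {L : Filter ι} [L.IsCountablyGenerated]
    {Φ : ι → X → ℝ} {Φ₀ : X → ℝ} {c : ℝ} (hmeas : ∀ i, MeasurableSet {x | Φ i x ≤ c}) (h0 : MeasurableSet {x | Φ₀ x ≤ c})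
    {B : Set X} (hB : MeasurableSet B) (hBfin : μ B ≠ ∞) (hsub : ∀ᶠ i in L, {x | Φ i x ≤ c} ⊆ B)
    (hpt : ∀ᵐ x ∂μ, Tendsto (fun i => Φ i x) L (𝓝 (Φ₀ x))) (hnull : ∀ᵐ x ∂μ, Φ₀ x ≠ c) :
    Tendsto (fun i => μ {x | Φ i x ≤ c}) L (𝓝 (μ {x | Φ₀ x ≤ c})) := by
  refine tendsto_measure_of_ae_tendsto_indicator L h0 hmeas hB hBfin hsub ?_
  filter_upwards [hpt, hnull] with x hx hxc
  simpa only [mem_setOf_eq] using eventually_le_iff_of_tendsto hx hxc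

/-- The two-scale filter is below the neighbourhood filter of `(0, 0, a₀)`: joint continuity at `(0,0,a₀)` gives the two-scale limit. [folklore] -/
theorem tendsto_twoScale_of_continuousAt {Y : Type*} [TopologicalSpace Y] {F : ℝ × ℝ × ℝ → Y} {a₀ : ℝ} (h : ContinuousAt F (0, 0, a₀)) :
    Tendsto (fun q : (ℝ × ℝ) × ℝ => F (q.1.1, q.1.2, q.2)) ((𝓝[>] (0 : ℝ) ×ˢ 𝓝[>] (0 : ℝ)) ×ˢ 𝓝 a₀) (𝓝 (F (0, 0, a₀))) := by
  have hu : Tendsto (fun q : (ℝ × ℝ) × ℝ => q.1.1) ((𝓝[>] (0 : ℝ) ×ˢ 𝓝[>] (0 : ℝ)) ×ˢ 𝓝 a₀) (𝓝 0) :=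
    (tendsto_fst.comp tendsto_fst).mono_right nhdsWithin_le_nhds
  have hs : Tendsto (fun q : (ℝ × ℝ) × ℝ => q.1.2) ((𝓝[>] (0 : ℝ) ×ˢ 𝓝[>] (0 : ℝ)) ×ˢ 𝓝 a₀) (𝓝 0) :=
    (tendsto_snd.comp tendsto_fst).mono_right nhdsWithin_le_nhds
  have ha : Tendsto (fun q : (ℝ × ℝ) × ℝ => q.2) ((𝓝[>] (0 : ℝ) ×ˢ 𝓝[>] (0 : ℝ)) ×ˢ 𝓝 a₀) (𝓝 a₀) := tendsto_snd
  exact h.tendsto.comp (hu.prodMk_nhds (hs.prodMk_nhds ha))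

/-- ★ **THE TWO-SCALE INSTANCE.**  `V(u,s,a) = μ{ξ | Φ(u,s,a;ξ) ≤ c} → μ{ξ | Φ(0,0,a₀;ξ) ≤ c}` along `(𝓝[>]0 ×ˢ 𝓝[>]0) ×ˢ 𝓝 a₀`, from: measurable
sublevel sets, joint continuity of `(u,s,a) ↦ Φ(u,s,a;ξ)` at `(0,0,a₀)` for a.e. `ξ`, the null level `μ{Φ(0,0,a₀;·) = c} = 0` (as an a.e. statement), and
eventual inclusion of the sublevel sets in a finite-measure `B`. [folklore] -/
theorem tendsto_measure_sublevel_twoScale {X : Type*} [MeasurableSpace X] {μ : Measure X} {Φ : ℝ × ℝ × ℝ → X → ℝ} {c a₀ : ℝ}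
    (hmeas : ∀ p, MeasurableSet {x | Φ p x ≤ c}) {B : Set X} (hB : MeasurableSet B) (hBfin : μ B ≠ ∞)
    (hsub : ∀ᶠ q : (ℝ × ℝ) × ℝ in (𝓝[>] (0 : ℝ) ×ˢ 𝓝[>] (0 : ℝ)) ×ˢ 𝓝 a₀, {x | Φ (q.1.1, q.1.2, q.2) x ≤ c} ⊆ B)
    (hcont : ∀ᵐ x ∂μ, ContinuousAt (fun p : ℝ × ℝ × ℝ => Φ p x) (0, 0, a₀)) (hnull : ∀ᵐ x ∂μ, Φ (0, 0, a₀) x ≠ c) :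
    Tendsto (fun q : (ℝ × ℝ) × ℝ => μ {x | Φ (q.1.1, q.1.2, q.2) x ≤ c}) ((𝓝[>] (0 : ℝ) ×ˢ 𝓝[>] (0 : ℝ)) ×ˢ 𝓝 a₀)
      (𝓝 (μ {x | Φ (0, 0, a₀) x ≤ c})) := by
  refine tendsto_measure_sublevel (Φ := fun q : (ℝ × ℝ) × ℝ => Φ (q.1.1, q.1.2, q.2)) (Φ₀ := Φ (0, 0, a₀)) (fun q => hmeas _) (hmeas _)
    hB hBfin hsub ?_ hnull
  filter_upwards [hcont] with x hx
  exact tendsto_twoScale_of_continuousAt (F := fun p : ℝ × ℝ × ℝ => Φ p x) hx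


/-! ## Appendix: sublevel sets cut by an eventually-frozen window -/

/-- ★ **WINDOW ∩ SUBLEVEL.**  As ✓`tendsto_measure_sublevel`, for sets `A i ∩ {Φ i ≤ c}` where the windows `A i` freeze a.e. (`x ∈ A i ↔ x ∈ A₀` eventually, for a.e. `x` —
e.g. balls `|u·x_I| < 1` whose limit boundary is null). [folklore] -/
theorem tendsto_measure_window_inter_sublevel {X ι : Type*} [MeasurableSpace X] {μ : Measure X} {L : Filter ι} [L.IsCountablyGenerated]
    {A : ι → Set X} {A₀ : Set X} {Φ : ι → X → ℝ} {Φ₀ : X → ℝ} {c : ℝ}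
    (hmeas : ∀ i, MeasurableSet (A i ∩ {x | Φ i x ≤ c})) (h0 : MeasurableSet (A₀ ∩ {x | Φ₀ x ≤ c}))
    {B : Set X} (hB : MeasurableSet B) (hBfin : μ B ≠ ∞) (hsub : ∀ᶠ i in L, A i ∩ {x | Φ i x ≤ c} ⊆ B)
    (hA : ∀ᵐ x ∂μ, ∀ᶠ i in L, x ∈ A i ↔ x ∈ A₀)
    (hpt : ∀ᵐ x ∂μ, Tendsto (fun i => Φ i x) L (𝓝 (Φ₀ x))) (hnull : ∀ᵐ x ∂μ, Φ₀ x ≠ c) :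
    Tendsto (fun i => μ (A i ∩ {x | Φ i x ≤ c})) L (𝓝 (μ (A₀ ∩ {x | Φ₀ x ≤ c}))) := by
  refine tendsto_measure_of_ae_tendsto_indicator L h0 hmeas hB hBfin hsub ?_
  filter_upwards [hA, hpt, hnull] with x hxA hx hxc
  filter_upwards [hxA, eventually_le_iff_of_tendsto hx hxc] with i hiA hi
  simp only [mem_inter_iff, mem_setOf_eq, hiA, hi]

/-- ★ The two-scale instance of the window ∩ sublevel lemma (joint continuity at `(0,0,a₀)` for a.e. `x` discharges the pointwise limit). [folklore] -/
theorem tendsto_measure_window_inter_sublevel_twoScale {X : Type*} [MeasurableSpace X] {μ : Measure X}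
    {A : ℝ × ℝ × ℝ → Set X} {Φ : ℝ × ℝ × ℝ → X → ℝ} {c a₀ : ℝ}
    (hmeas : ∀ p, MeasurableSet (A p ∩ {x | Φ p x ≤ c})) {B : Set X} (hB : MeasurableSet B) (hBfin : μ B ≠ ∞)
    (hsub : ∀ᶠ q : (ℝ × ℝ) × ℝ in (𝓝[>] (0 : ℝ) ×ˢ 𝓝[>] (0 : ℝ)) ×ˢ 𝓝 a₀, A (q.1.1, q.1.2, q.2) ∩ {x | Φ (q.1.1, q.1.2, q.2) x ≤ c} ⊆ B)
    (hA : ∀ᵐ x ∂μ, ∀ᶠ q : (ℝ × ℝ) × ℝ in (𝓝[>] (0 : ℝ) ×ˢ 𝓝[>] (0 : ℝ)) ×ˢ 𝓝 a₀, x ∈ A (q.1.1, q.1.2, q.2) ↔ x ∈ A (0, 0, a₀))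
    (hcont : ∀ᵐ x ∂μ, ContinuousAt (fun p : ℝ × ℝ × ℝ => Φ p x) (0, 0, a₀)) (hnull : ∀ᵐ x ∂μ, Φ (0, 0, a₀) x ≠ c) :
    Tendsto (fun q : (ℝ × ℝ) × ℝ => μ (A (q.1.1, q.1.2, q.2) ∩ {x | Φ (q.1.1, q.1.2, q.2) x ≤ c}))
      ((𝓝[>] (0 : ℝ) ×ˢ 𝓝[>] (0 : ℝ)) ×ˢ 𝓝 a₀) (𝓝 (μ (A (0, 0, a₀) ∩ {x | Φ (0, 0, a₀) x ≤ c}))) := by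
  refine tendsto_measure_window_inter_sublevel (A := fun q : (ℝ × ℝ) × ℝ => A (q.1.1, q.1.2, q.2))
    (Φ := fun q : (ℝ × ℝ) × ℝ => Φ (q.1.1, q.1.2, q.2)) (Φ₀ := Φ (0, 0, a₀)) (fun q => hmeas _) (hmeas _) hB hBfin hsub hA ?_ hnull
  filter_upwards [hcont] with x hx
  exact tendsto_twoScale_of_continuousAt (F := fun p : ℝ × ℝ × ℝ => Φ p x) hx

end Summit.QuantumFields.YangMills.Theorems.SwapVirialDeficit.BlowUp

end
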